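import Literature.Geometry.Lorentzian.ExteriorRegion
import HarnessLib

/-!
# Outermost horizons: Bray's Riemannian Penrose inequality for exterior regions and the
# reduction of the general-horizon statement (family `gr`, statement **gr.S09**; namespace
# `Literature.GR`)

This file continues `ExteriorRegion.lean` (Huisken–Ilmanen's exterior regions, for a *connected*
horizon) for the **general, possibly disconnected, horizon** of Bray, J. Differential Geom. 59
(2001) 177–267 (= arXiv:math/9911173, same numbering):

* **Thm. 19** (p. 240; §13 of the arXiv version). *Let `(M³, g)` be a complete, smooth,
  asymptotically flat `3`-manifold with boundary which has nonnegative scalar curvature and total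
  mass `m`. Then if the boundary is an outer-minimizing horizon (with one or more components) of
  total area `A`, then `m ≥ √(A/16π)`, with equality if and only if `(M³, g)` is isometric to a
  Schwarzschild manifold outside their respective outermost horizons.* (Thm. 1, p. 185, is the
  boundaryless version; "none of the arguments in this paper have used anything about the
  original manifold inside the original horizon", before Thm. 19.) Here *asymptotically flat* is
  Def. 21 (p. 238: finitely many ends `Φ_k : E_k ≅ ℝ³ ∖ B₁(0)` with `g_ij = δ_ij + O(|x|^{-p})`,
  `|x| |g_ij,k| + |x|² |g_ij,kl| = O(|x|^{-p})`, `|R(g)| = O(|x|^{-q})`, `p > 1/2`, `q > 3`), the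
  *total mass* is the flux limit (225) `(16π)⁻¹ lim_σ ∮_{S_σ} Σ (g_ij,i - g_ii,j) ν_j dμ` (whose
  existence Def. 21 implies), a *horizon* is a smooth compact zero mean curvature boundary
  `Σ = ∂G` of an open set containing the non-chosen ends (Defs. 3–4), and `Σ` is
  *outer-minimizing* if every such surface enclosing it has at least its area (Def. 6).
* Huisken–Ilmanen, J. Differential Geom. 59 (2001) 353–437, §4, **Lemma 4.1 (ii)**:
  *a `3`-dimensional exterior region `M'` (connected, asymptotically flat, compact minimal
  boundary, no other compact minimal surfaces even immersed) is diffeomorphic to `ℝ³` minus a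
  finite number of open `3`-balls with disjoint closures, and the boundary of `M'` minimizes area
  in its homology class* (end of the proof of Lemma 4.1 in §4: "using large spheres as barriers,
  there is some area-minimizing compact surface `N` homologous to `∂M'`, but since `M'` is an
  exterior region, `N` must lie in `∂M'`"). A surface `Σ̃ ∈ 𝒮` enclosing `∂M'` bounds, together
  with `∂M'`, the compact region in between, so is homologous to `∂M'` in `M'`: hence *the
  boundary of an exterior region is an outer-minimizing horizon* (Bray, p. 185: "outermost
  horizons are always strictly outer-minimizing").

Contents:

* `riemannian_penrose_inequality_smooth` — the **corrected statement** of the named fact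
  `riemannian_penrose_inequality` of `MassInequalities.lean` (gr.S09, general horizon): the original
  hypotheses verbatim plus smoothness of the unit normal `S.ν` (the minimal repair, exactly as
  `riemannian_penrose_inequality_connected_smooth` repairs the connected-horizon fact), see the next
  section; reduced to the named facts below in `OutermostHorizonSmooth.lean`;
* `riemannian_penrose_inequality_outermost` — the same statement with the outermost hypothesis
  in the **printed form** of Huisken–Ilmanen's condition (iii) / Bray's Def. 5 (every image of a
  compact immersed minimal surface in `closure S.exterior` lies in `S`) in place of
  `IsMinimalSurfaceFree`; this is the form the reduction below consumes and produces;
* `Bray2001_penrose_inequality_exteriorRegion` — **named fact**: Thm. 19 combined with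
  Lemma 4.1 (ii), for an exterior region presented, as in `ExteriorRegion.lean`, as an open
  `U ⊆ X` of the boundaryless data manifold with compact minimal topological boundary
  `∂U = range B.f` (`MinimalBoundary`) containing no other compact immersed minimal surface:
  `√(|Σ₀|/16π) ≤ m` for every compact surface `Σ₀` smoothly embedded into `∂U`;
* `riemannian_penrose_inequality_outermost_of_exteriorRegion` — **theorem**: the named facts
  `exteriorRegion_structure` (`ExteriorRegion.lean`: Huisken–Ilmanen, Lemma 4.1 (i)) and
  `Bray2001_penrose_inequality_exteriorRegion` imply `riemannian_penrose_inequality_outermost`.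
  This is reduction (b) of the module docstring of `MassInequalities.lean`, machine-checked:
  under the printed outermost hypothesis the exterior component `U = V ∖ K(V)` of `V = S.exterior`
  given by Lemma 4.1 has `∂U ⊆ S` (its boundary is a compact minimal surface in `closure V`),
  hence `V ∩ ∂U = ∅` and, `V` being connected and meeting `U`, `V = U`
  (`IsPreconnected.subset_of_closure_inter_subset`); so `S.exterior` *is* the exterior region of
  the end `e`, with boundary `S`, and the fact applies to `Σ₀ = S`.

The analytic content of Bray's proof — Lemma 1 (Schoen–Yau: density of metrics harmonically
flat at infinity), Thm. 2/Thm. 18 (existence and regularity of the conformal flow of metrics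
`g_t = u_t⁴ g₀`, §4 and App. E), Thm. 3 (§5: `A(t)` constant; §§6–7: `m(t)` nonincreasing, by the
positive mass theorem, Thm. 8, and the mass–capacity theorem, Thm. 9, vendored in
`MassCapacity.lean`), Thm. 4 (§§8–12: convergence to Schwarzschild, `m(t)/√A(t) → (16π)^{-1/2}`)
and the perturbation argument of §13 (the inequality (226) `m(t) ≥ √(A(t)/16π)` for
asymptotically flat manifolds, by Lemma 1 and Thms. 3–4) — sits entirely inside
`Bray2001_penrose_inequality_exteriorRegion`, whose decomposition along these printed steps is
the subject of further files.

## The corrected statement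

`riemannian_penrose_inequality` (`MassInequalities.lean`) is **mis-stated** — and, like
`riemannian_penrose_inequality_connected` and `riemannian_penrose_rigidity`, **deprecated**
(2026-08-15, statement kept verbatim under its ledger-referenced name) — in the way recorded
there (section "gr.S09, connected horizon: corrected statement") for
`riemannian_penrose_inequality_connected`: the hypothesis structure `OutermostMOTS`
(`TrappedSurface.lean`) imposes no regularity on the unit normal `S.ν` (a bare `NormalField`,
constrained pointwise by `isUnitNormal` and `pointsInto`). Along a component of `S` on both of
whose sides `S.exterior` lies — allowed by the hypotheses `IsExteriorRegion e S.exterior` and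
`IsMinimalSurfaceFree D.h S.exterior` of that fact (a non-separating horizon with
`S.exterior = X ∖ S`, the configuration its docstring treats by doubling) — `pointsInto` holds
for both signs, `S.ν` may flip sign on a set meeting every arc, the coefficient derivatives inside
`normalDerivAlong`/`covariantDerivAlong` (`Geodesic.lean`: `deriv`, junk value `0`) vanish, and
`S.isMOTS` (`H = 0`) can hold although that component is no minimal surface. In such a
configuration the sources do not yield the conclusion `√(|S|/16π) ≤ E`: the exterior region of
the end (Lemma 4.1) may then have boundary spheres crossing the non-minimal component, of total
area unrelated to `|S|`, and Thm. 19 bounds `m` below by that area. (For a component along which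
`S.exterior` is one-sided, `pointsInto` pins `S.ν` to the smooth outward normal and no junk
arises.)

The corrected statement `riemannian_penrose_inequality_smooth` therefore **adds the smoothness of
`S.ν`** as a map into `TX` (exactly as `riemannian_penrose_inequality_connected_smooth` does) and
keeps every other hypothesis and the conclusion of `riemannian_penrose_inequality` verbatim. It is
implied by the sources: with a smooth normal `S` is an honest compact minimal surface bounding
`V = S.exterior`; by Lemma 4.1 (i) the exterior component `U = V ∖ K(V)` of the end in `V` is
bounded by embedded minimal spheres in `closure V = V ∪ S`; a sphere inside the open `V` is
excluded by `IsMinimalSurfaceFree`; a sphere meeting a component `Sᵢ` of `S` contains it (`Sᵢ`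
misses `U ⊆ V` and touches `∂U`: boundary maximum principle,
`minimalSurface_boundary_maximumPrinciple` of `ExteriorRegion.lean`) and then coincides with it
(invariance of domain for the compact surface `Sᵢ` inside the connected sphere); so `∂U ⊆ S`,
`U = V` by connectedness of `V`, `∂U = S`, and Thm. 19 with Lemma 4.1 (ii) applies to the metric
completion of `U`. The two parenthetical steps — restricting the embedded minimal surfaces `S`
and `∂U` to single components, and invariance of domain for surfaces — are supplied downstream by
`HypersurfaceRestriction.lean` (restriction of immersed hypersurfaces to open subsets preserves
the mean curvature) and by the fill lemma `image_connectedComponent_eq_of_subset_range` of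
`OutermostHorizonSmooth.lean` (a smooth substitute for invariance of domain), which imports this
file and **proves** the reduction: `riemannian_penrose_inequality_smooth_of_exteriorRegion :
exteriorRegion_structure → Bray2001_penrose_inequality_exteriorRegion →
minimalSurface_boundary_maximumPrinciple → riemannian_penrose_inequality_smooth`, and
`riemannian_penrose_inequality_smooth_of_barrierPrinciple` (maximum principle reduced to the
barrier principle of `MinimalSurfaceBarrier.lean`).

The variant `riemannian_penrose_inequality_outermost` states the outermost hypothesis instead in
the printed form in which reduction (b) consumes it — Huisken–Ilmanen's condition (iii) for the
closed region `closure S.exterior` ("contains no other compact minimal surfaces (even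
immersed)", Main Theorem and Lemma 4.1; Bray's Def. 5, "not enclosed by another horizon"): every
image of a compact immersed minimal surface with smooth unit normal (`IsMinimalSurfaceImage`,
`ExteriorRegion.lean`) contained in `closure S.exterior` lies in `S` — in place of
`IsMinimalSurfaceFree D.h S.exterior` (no compact *embedded* minimal surface, with an *arbitrary*
unit normal field, inside the *open* exterior; `OutermostMOTS.no_weaklyOuterTrapped_in_exterior`
remains, as a field of the structure). This is the hypothesis of
`riemannian_penrose_inequality_exteriorRegion` (`ExteriorRegion.lean`) and the conclusion of
`subset_frontier_of_isMinimalSurfaceImage` there, so that the reduction to Thm. 19 closes in this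
file without the two extra steps (`riemannian_penrose_inequality_outermost_of_exteriorRegion`). For a
horizon
with smooth normal the printed form follows from the `IsMinimalSurfaceFree` form by the argument
of the previous paragraph (`U = V` makes `K(V)`, which contains every compact immersed minimal
surface in `closure V`, miss `V`); the converse fails only through the junk normal fields over
which `IsMinimalSurfaceFree` quantifies. All other hypotheses and the conclusion are again those
of `riemannian_penrose_inequality` verbatim.

## Mathlib

As for `ExteriorRegion.lean`: Mathlib (at the pin) has no minimal surfaces, no manifolds with
boundary obtained as closures or metric completions of open regions, no ADM mass; used are
`TopologicalSpace.Opens`, `frontier`/`closure`, `IsPreconnected.subset_of_closure_inter_subset`,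
`Asymptotics.IsBigO` along `Bornology.cobounded`, `Real.sqrt`, `ENNReal.toReal`, and the H21
Lorentz prelude (`OutermostMOTS` + `surfaceArea`/`exterior`/`toMinimalBoundary`,
`MinimalBoundary`, `IsMinimalSurfaceImage`, `trappedSet`, `exteriorRegion_structure`,
`subset_frontier_of_isMinimalSurfaceImage`, `IsExteriorRegion`, `AFEnd` +
`IsAsymptoticallyFlat`/`IsMetricAsymptoticallyFlat`/`scalarCurvatureCoeff`/`HasADMEnergy`/
`admEnergy`, `InitialDataSet` + `IsTimeSymmetric`/`IsComplete`/`metric`, `scalarCurvature`,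
`totalArea`, `inducedRiemannianMetric`, `contMDiff_pullbackBilin`).

## Design choices

* *Open-set encoding of Bray's manifold with boundary* (as in `ExteriorRegion.lean`). The
  printed `(M³, g)` of Thm. 19 is the metric completion `M'` of an open connected region `U` of
  the complete boundaryless data manifold `(X, h)` whose topological boundary `∂U = range B.f`
  is a compact smoothly embedded minimal surface with smooth unit normal pointing into `U`
  (`B : MinimalBoundary D.h U`); `M'` is a smooth manifold with boundary (a collar along each
  component of `∂U`, a component on both of whose sides `U` lies being doubled), complete (`X`
  is), with interior `U`. "One chosen end, the rest compact" is `IsExteriorRegion e U`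
  (`U` connected, `e.far R' ⊆ U`, `closure U ∖ e.far R'` compact, so `K = M' ∖ e.far R'` is the
  compact set of Def. 21 and `M' ∖ K ≅ {R' < ‖x‖}` the one end).
* *Faithfulness of the hypotheses.* Def. 21 is put on the end `e` as: metric decay of order `1`,
  `h - δ = O₂(r⁻¹)` in the chart of `e` (`IsMetricAsymptoticallyFlat e D 1`, i.e. `p = 1 > 1/2`;
  Bray's chart is onto `ℝ³ ∖ B₁(0)`, ours onto `{R < ‖x‖}`, immaterial for decay rates), **and**
  `|R(h)| = O(r^{-q})` for some `q > 3` (`scalarCurvatureCoeff`, as in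
  `riemannian_penrose_inequality`); the total mass is `m = e.admEnergy D`, the flux limit (225)
  with the same normalisation `(16π)⁻¹ ∮ Σ_ij (∂_j h_ij - ∂_i h_jj) xⁱ/r` (`admEnergyFlux`), under
  the explicit hypothesis that the limit exists (asserted after (225); it keeps `admEnergy`
  honest). Nonnegative scalar curvature is asked on `closure U` only. "The boundary is an
  outer-minimizing horizon" is supplied by Lemma 4.1 (ii) from the exterior-region hypothesis,
  stated exactly as in `riemannian_penrose_inequality_exteriorRegion` (`ExteriorRegion.lean`):
  every image of a compact immersed minimal surface (smooth unit normal) contained in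
  `closure U` lies in `∂U` — then `M'` is an exterior region in Huisken–Ilmanen's sense (a
  compact minimal surface immersed in `M'` projects to one in `closure U`), `∂M'` minimises area
  in its homology class in `M'`, and is in particular outer-minimizing, of total area
  `A = |∂M'| ≥ |∂U|` (doubled components counted twice in `A`).
* *Faithfulness of the conclusion.* Thm. 19 gives `m ≥ √(A/16π)`. The fact concludes
  `√(|Σ₀|/16π) ≤ m` for every compact surface `S₀` (connected or not) smoothly embedded into `X`
  by `f₀` with `range f₀ ⊆ ∂U`, where `|Σ₀| = totalArea (f₀^* h)` is the Riemannian area of the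
  embedded image (Federer 1969, §3.2.46), at most `|∂U| ≤ A`; this is the form in which
  `OutermostMOTS.surfaceArea` is defined, so that no area-comparison fact is needed downstream.
  The rigidity clause is not vendored here (see `riemannian_penrose_rigidity` and
  `MassCapacity.lean`).
* *The tensor `k`.* The facts concern the Riemannian manifold `(X, h)`; the data set `D` enters
  only through `h` (and `k = 0` is kept among the hypotheses of the gr.S09 statement, as in the
  original).

## References

* H. L. Bray, *Proof of the Riemannian Penrose inequality using the positive mass theorem*,
  J. Differential Geom. 59 (2001) 177–267 (arXiv:math/9911173): §1, (5) (p. 181, the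
  positive mass theorem); §2, Lemma 1, Defs. 1–6 and Thm. 1 (pp. 183–185), remark before Thm. 1
  ("outermost horizons are always strictly outer-minimizing"); §3, Thms. 2–4 (pp. 186–188); §6,
  Thms. 8–9; §13, Def. 21, (225), Thms. 18–19 (pp. 238–240).
* G. Huisken, T. Ilmanen, *The inverse mean curvature flow and the Riemannian Penrose
  inequality*, J. Differential Geom. 59 (2001) 353–437: §0, Main Theorem and condition (iii);
  §4, "Exterior and Trapped Regions", Lemma 4.1 (i)–(ii) and its proof; §8, step 1 (`m ≥ 0`).
* H. Federer, *Geometric Measure Theory*, Springer 1969, §3.2.46.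
-/

noncomputable section

open Bundle Set Manifold TopologicalSpace Filter MeasureTheory Asymptotics
open scoped ContDiff Topology ENNReal Manifold Real

namespace Literature.Geometry.Lorentzian

open PseudoRiemannianMetric

/-! ### gr.S09, general horizon: the corrected statements -/

/-- **gr.S09** (Riemannian Penrose inequality, general horizon; **corrected form** of
`riemannian_penrose_inequality` of `MassInequalities.lean`, see the module docstring, section
"The corrected statement", for the discrepancy: the original imposes no regularity on the unit
normal `S.ν`, so that its `H = 0` may be vacuous). Named fact: Bray, J. Differential Geom. 59
(2001), Thm. 19 (p. 240): *let `(M³, g)` be a complete smooth asymptotically flat `3`-manifold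
with boundary with nonnegative scalar curvature and total mass `m`; if the boundary is an
outer-minimizing horizon (with one or more components) of total area `A`, then `m ≥ √(A/16π)`*
(Thm. 1, p. 185, is the boundaryless version), where "asymptotically flat" is Def. 21 (p. 238):
ends `≅ ℝ³ ∖ B₁(0)` with `g = δ + O(|x|^{-p})`, `|x||∂g| + |x|²|∂²g| = O(|x|^{-p})`, `p > 1/2`,
**and** `|R(g)| = O(|x|^{-q})`, `q > 3`, and the total mass is the flux limit (225). Applied to
the exterior region `M'` of the end `e` (Huisken–Ilmanen, J. Differential Geom. 59 (2001),
Lemma 4.1 (i)), whose interior is `S.exterior` and whose boundary is `S` under the hypotheses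
below (module docstring, "The corrected statement"), and whose boundary is outer-minimizing by
their Lemma 4.1 (ii). Hypotheses — those of `riemannian_penrose_inequality` verbatim **plus
smoothness of the unit normal `S.ν`** as a map into `TX` (so that `S.isMOTS` is the honest
minimal-surface equation `H = 0`; automatic for one-sided exteriors): `k = 0`; `R(h) ≥ 0`;
asymptotic flatness of order `1` on `e` **and** Bray's curvature decay
`scalarCurvatureCoeff e D = O(‖x‖^{-q})` for some `q > 3`; completeness; existence of the ADM
energy limit (`m = E`); an outermost minimal surface `S` (possibly disconnected, possibly empty)
whose exterior is the connected exterior region of the end `e` (`IsExteriorRegion`) containing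
no closed minimal surface (`IsMinimalSurfaceFree`). Conclusion: `√(|S| / 16π) ≤ E`, `|S|` the
total area of `S`. See `riemannian_penrose_inequality_outermost` for the variant with the
outermost hypothesis in printed form, reduced to Thm. 19 in this file.
[cite: BrayRPI2001, Thm. 19 (p. 240) and Thm. 1 with Def. 21 and (225)]
[cite: HuiskenIlmanenIMCF2001, Lemma 4.1 (i)–(ii)] -/
def riemannian_penrose_inequality_smooth : Prop :=
  ∀ (X : Type) [TopologicalSpace X] [ChartedSpace E3 X] [IsManifold (𝓡 3) ∞ X] [T2Space X]
    [SecondCountableTopology X] [ConnectedSpace X]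
    (D : InitialDataSet (𝓡 3) X) [D.metric.HasLeviCivita] (e : AFEnd X)
    (S : OutermostMOTS (𝓡 3) D.h 0),
    ContMDiff (𝓡 2) (𝓡 3).tangent ∞
      (fun y ↦ (TotalSpace.mk' E3 (S.f y) (S.ν y) : TangentBundle (𝓡 3) X)) →
    D.IsTimeSymmetric → (∀ x : X, 0 ≤ D.metric.scalarCurvature x) →
    e.IsAsymptoticallyFlat D 1 →
    (∃ q : ℝ, 3 < q ∧
      (fun x ↦ e.scalarCurvatureCoeff D x) =O[Bornology.cobounded E3] fun x ↦ ‖x‖ ^ (-q)) →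
    D.IsComplete → (∃ m, e.HasADMEnergy D m) →
    IsMinimalSurfaceFree D.h S.exterior → IsExteriorRegion e S.exterior →
    Real.sqrt (S.surfaceArea.toReal / (16 * π)) ≤ e.admEnergy D

-- `linter.deprecated` is switched off for the next declaration only: its hypothesis is the
-- mis-stated fact `riemannian_penrose_inequality`, deprecated (2026-08-15) in `MassInequalities.lean`
-- in favour of `riemannian_penrose_inequality_smooth` above; the bridge is kept (deprecated itself)
-- as the machine-checked record that the correction only adds a hypothesis.
set_option linter.deprecated false in
/-- **Deprecated** (2026-08-15) together with its hypothesis, the mis-stated fact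
`riemannian_penrose_inequality` of `MassInequalities.lean`: use the corrected named fact
`riemannian_penrose_inequality_smooth` directly, or its machine-checked reductions
`riemannian_penrose_inequality_smooth_of_exteriorRegion` /
`riemannian_penrose_inequality_smooth_of_barrierPrinciple` (`OutermostHorizonSmooth.lean`) and
`riemannian_penrose_inequality_outermost_of_exteriorRegion` (below). *Content (unchanged):* the
mis-stated fact implies its corrected form — the correction only *adds* the smoothness
hypothesis on `S.ν` — recorded so that any user of the old name can migrate, and as the check
that the corrected statement is not stronger than the original.
[cite: BrayRPI2001, Thm. 19 (p. 240)] -/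
@[deprecated "the hypothesis `riemannian_penrose_inequality` is mis-stated (unit normal `S.ν` unconstrained): use Literature.Geometry.Lorentzian.riemannian_penrose_inequality_smooth, or its reductions in OutermostHorizonSmooth.lean" (since := "2026-08-15")]
theorem riemannian_penrose_inequality_smooth_of (h : riemannian_penrose_inequality) :
    riemannian_penrose_inequality_smooth :=
  fun X _ _ _ _ _ _ D _ e S _ ↦ h X D e S

/-- **gr.S09** (Riemannian Penrose inequality, general horizon, **outermost hypothesis in printed
form**; variant of the corrected statement `riemannian_penrose_inequality_smooth`, see the module
docstring, section "The corrected statement"). Named fact: Bray, J. Differential Geom. 59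
(2001), Thm. 19 (p. 240): *let `(M³, g)` be a complete smooth asymptotically flat `3`-manifold
with boundary with nonnegative scalar curvature and total mass `m`; if the boundary is an
outer-minimizing horizon (with one or more components) of total area `A`, then `m ≥ √(A/16π)`*
(Thm. 1, p. 185, is the boundaryless version), with "asymptotically flat" as in Def. 21 (p. 238:
`g = δ + O₂(|x|^{-p})`, `p > 1/2`, **and** `|R(g)| = O(|x|^{-q})`, `q > 3`) and the total mass the
flux limit (225); applied to the exterior region `M'` of the end `e` (Huisken–Ilmanen, J.
Differential Geom. 59 (2001), Lemma 4.1 (i)), whose boundary is outer-minimizing by their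
Lemma 4.1 (ii). Hypotheses: `k = 0`; `R(h) ≥ 0` on `X`; asymptotic flatness of order `1` on `e`
and Bray's curvature decay `scalarCurvatureCoeff e D = O(‖x‖^{-q})` for some `q > 3`;
completeness of `X`; existence of the ADM energy limit (`m = E = e.admEnergy D`); an outermost
minimal surface `S : OutermostMOTS (𝓡 3) D.h 0` (possibly disconnected, possibly empty) **whose
unit normal `S.ν` is smooth** as a map into `TX` (so that `S.isMOTS` is the honest equation
`H = 0`), whose exterior `S.exterior` is the connected exterior region of the end `e`, compact
modulo the end (`IsExteriorRegion`), and which is **outermost in the printed sense** of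
Huisken–Ilmanen's condition (iii) / Bray's Def. 5: every image of a compact immersed minimal
surface with smooth unit normal (`IsMinimalSurfaceImage`) contained in `closure S.exterior` lies
in `S` (in place of `IsMinimalSurfaceFree D.h S.exterior`). Then
(`riemannian_penrose_inequality_outermost_of_exteriorRegion`) `S.exterior` is the exterior region
of `e` with boundary `S`, and Thm. 19 gives the conclusion `√(|S|/16π) ≤ E`,
`|S| = S.surfaceArea` the total area of `S`.
[cite: BrayRPI2001, Thm. 19 (p. 240) and Thm. 1 with Def. 21 and (225)]
[cite: HuiskenIlmanenIMCF2001, Lemma 4.1 (i)–(ii)] -/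
def riemannian_penrose_inequality_outermost : Prop :=
  ∀ (X : Type) [TopologicalSpace X] [ChartedSpace E3 X] [IsManifold (𝓡 3) ∞ X] [T2Space X]
    [SecondCountableTopology X] [ConnectedSpace X]
    (D : InitialDataSet (𝓡 3) X) [D.metric.HasLeviCivita] (e : AFEnd X)
    (S : OutermostMOTS (𝓡 3) D.h 0),
    ContMDiff (𝓡 2) (𝓡 3).tangent ∞
      (fun y ↦ (TotalSpace.mk' E3 (S.f y) (S.ν y) : TangentBundle (𝓡 3) X)) →
    D.IsTimeSymmetric → (∀ x : X, 0 ≤ D.metric.scalarCurvature x) →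
    e.IsAsymptoticallyFlat D 1 →
    (∃ q : ℝ, 3 < q ∧
      (fun x ↦ e.scalarCurvatureCoeff D x) =O[Bornology.cobounded E3] fun x ↦ ‖x‖ ^ (-q)) →
    D.IsComplete → (∃ m, e.HasADMEnergy D m) →
    (∀ N, IsMinimalSurfaceImage D.h N → N ⊆ closure (S.exterior : Set X) → N ⊆ range S.f) →
    IsExteriorRegion e S.exterior →
    Real.sqrt (S.surfaceArea.toReal / (16 * π)) ≤ e.admEnergy D

/-! ### Bray's Theorem 19 for exterior regions -/

/-- **Riemannian Penrose inequality for exterior regions, total area form** (named fact).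
Bray, J. Differential Geom. 59 (2001), Thm. 19 (p. 240): *let `(M³, g)` be a complete, smooth,
asymptotically flat `3`-manifold with boundary which has nonnegative scalar curvature and total
mass `m`; if the boundary is an outer-minimizing horizon (with one or more components) of total
area `A`, then `m ≥ √(A/16π)`* — with asymptotic flatness as in Def. 21 (`g_ij = δ_ij +
O(|x|^{-p})`, `|x||g_ij,k| + |x|²|g_ij,kl| = O(|x|^{-p})`, `|R(g)| = O(|x|^{-q})`, `p > 1/2`,
`q > 3`) and `m` the flux limit (225) — combined with Huisken–Ilmanen, J. Differential Geom. 59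
(2001), Lemma 4.1 (ii): *the boundary of a `3`-dimensional exterior region (connected,
asymptotically flat, compact minimal boundary, no other compact minimal surfaces even immersed)
minimizes area in its homology class*, so that it is an outer-minimizing horizon (a surface
enclosing `∂M'` is homologous to it in `M'`; Bray, p. 185: "outermost horizons are always
strictly outer-minimizing"). Vendored, as `riemannian_penrose_inequality_exteriorRegion` of
`ExteriorRegion.lean`, for `M'` the metric completion of an open connected region `U` of the
complete boundaryless data manifold `(X, h)` (`D.IsComplete`) with compact minimal topological
boundary `∂U = range B.f` (`B : MinimalBoundary D.h U`: a compact smoothly embedded surface with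
smooth unit normal pointing into `U` and `H = 0`; `M'` is a smooth complete manifold with
boundary, a component of `∂U` with `U` on both sides giving two components of `∂M'`) and exactly
one end, the end `e` (`IsExteriorRegion e U`: `U` connected, `e.far R' ⊆ U`,
`closure U ∖ e.far R'` compact — the compact set `K` of Def. 21), on which Def. 21 holds:
`h - δ = O₂(r⁻¹)` in the chart of `e` (`IsMetricAsymptoticallyFlat e D 1`, `p = 1`) and
`|R(h)| = O(r^{-q})` for some `q > 3` (`scalarCurvatureCoeff`), the ADM energy flux limit
existing (it is then `m = e.admEnergy D`, same normalisation as (225)); nonnegative scalar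
curvature on `closure U`; and the exterior-region hypothesis as in
`riemannian_penrose_inequality_exteriorRegion`: every image of a compact immersed minimal
surface of `X` (smooth unit normal) contained in `closure U` is contained in `∂U` (so `M'` is an
exterior region and `∂M'` is outer-minimizing, of total area `A = |∂M'| ≥ |∂U|`). Conclusion:
`√(|Σ₀|/16π) ≤ m` for every compact surface `S₀` (connected or not) smoothly embedded into `X`
by `f₀` with `range f₀ ⊆ ∂U`, `|Σ₀| = totalArea (f₀^* h)` being the Riemannian area of the
image (Federer 1969, §3.2.46), at most `|∂U| ≤ A`. For `∂U = ∅` (then `U = X` contains no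
compact minimal surface at all, `S₀ = ∅` and `|Σ₀| = 0`) the conclusion reads `0 ≤ m`: the
Riemannian positive mass theorem as stated by Bray (p. 181, (5): complete smooth asymptotically
flat `3`-manifolds with nonnegative scalar curvature have `m ≥ 0`; Schoen–Yau), on which his
proof rests (§6), and which is also the first conclusion `m ≥ 0` of Huisken–Ilmanen's Main
Theorem for exterior regions, vendored with weaker decay hypotheses as
`riemannian_penrose_inequality_exteriorRegion`. The rigidity clause is not vendored. The tensor
`k` of `D` plays no role.
[cite: BrayRPI2001, Thm. 19 (p. 240) with Def. 21 and (225), p. 181 (5), and p. 185 before Thm. 1]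
[cite: HuiskenIlmanenIMCF2001, §4, Lemma 4.1 (ii) and its proof, and Main Theorem (m ≥ 0)] -/
def Bray2001_penrose_inequality_exteriorRegion : Prop :=
  ∀ (X : Type) [TopologicalSpace X] [ChartedSpace E3 X] [IsManifold (𝓡 3) ∞ X] [T2Space X]
    [SecondCountableTopology X] [ConnectedSpace X]
    (D : InitialDataSet (𝓡 3) X) [D.metric.HasLeviCivita] (e : AFEnd X) (U : Opens X)
    (B : MinimalBoundary D.h (U : Set X)),
    D.IsComplete → IsExteriorRegion e U → e.IsMetricAsymptoticallyFlat D 1 →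
    (∃ q : ℝ, 3 < q ∧
      (fun x ↦ e.scalarCurvatureCoeff D x) =O[Bornology.cobounded E3] fun x ↦ ‖x‖ ^ (-q)) →
    (∃ m, e.HasADMEnergy D m) →
    (∀ x ∈ closure (U : Set X), 0 ≤ D.metric.scalarCurvature x) →
    (∀ N, IsMinimalSurfaceImage D.h N → N ⊆ closure (U : Set X) → N ⊆ range B.f) →
    ∀ (S₀ : Type) [TopologicalSpace S₀] [ChartedSpace (EuclideanSpace ℝ (Fin 2)) S₀]
      [IsManifold (𝓡 2) ∞ S₀] [CompactSpace S₀] [T2Space S₀]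
      [MeasurableSpace S₀] [BorelSpace S₀]
      (f₀ : S₀ → X) (hpb₀ : contMDiff_pullbackBilin (𝓡 3) X (𝓡 2) S₀ ∞)
      (hf₀ : (ofRiemannian D.h).IsSpacelikeImmersion (𝓡 2) f₀),
      Manifold.IsSmoothEmbedding (𝓡 2) (𝓡 3) ∞ f₀ → range f₀ ⊆ range B.f →
      Real.sqrt ((totalArea ((ofRiemannian D.h).inducedRiemannianMetric f₀ hpb₀ hf₀)).toReal /
        (16 * π)) ≤ e.admEnergy D

/-! ### The exterior of an outermost horizon is the exterior region of the end -/

section Reduction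

variable {X : Type} [TopologicalSpace X] [ChartedSpace E3 X] [IsManifold (𝓡 3) ∞ X]

omit [ChartedSpace E3 X] [IsManifold (𝓡 3) ∞ X] in
/-- *A connected open set meeting an open subset whose boundary it avoids is contained in it*
(point-set step of the reduction: `V` connected, `U ⊆ V` open and nonempty, `V ∩ ∂U = ∅` imply
`V ⊆ U`, hence `U = V`). [folklore] -/
lemma subset_of_isPreconnected_of_frontier_disjoint {U V : Set X} (hV : IsPreconnected V)
    (hU : IsOpen U) (hUV : U ⊆ V) (hne : U.Nonempty) (hfr : Disjoint V (frontier U)) :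
    V ⊆ U := by
  refine hV.subset_of_closure_inter_subset hU ?_ ?_
  · obtain ⟨x, hx⟩ := hne
    exact ⟨x, hUV hx, hx⟩
  · rintro x ⟨hxc, hxV⟩
    by_contra hxU
    refine Set.disjoint_left.1 hfr hxV ⟨hxc, ?_⟩
    rwa [hU.interior_eq]

/-- **The exterior of an outermost horizon is Huisken–Ilmanen's exterior region** (Huisken–
Ilmanen 2001, §4, Lemma 4.1 (i), read for an outermost horizon). Let `S` be an outermost minimal
surface with smooth unit normal, `V = S.exterior`, outermost in the printed sense (every compact
immersed minimal surface in `closure V` lies in `S`), and let `U ⊆ X` be open, nonempty, with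
`U = V ∖ K(V)` and compact minimal boundary `∂U = range B.f` (as provided by
`exteriorRegion_structure`); suppose `V` is connected. Then `U = V` and `∂U = S`: the boundary
`∂U` is (empty or) the image of a compact minimal surface contained in `closure U ⊆ closure V`,
hence lies in `S = ∂V`, which misses the open `V`; so `V ∩ ∂U = ∅` and the connected `V ⊇ U`
lies in `U`. [cite: HuiskenIlmanenIMCF2001, §4, Lemma 4.1 (i)] -/
theorem OutermostMOTS.exterior_eq_of_outermost
    {h : ContMDiffRiemannianMetric (𝓡 3) ∞ E3 (TangentSpace (𝓡 3) : X → Type _)}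
    [(ofRiemannian h).HasLeviCivita] (S : OutermostMOTS (𝓡 3) h 0)
    (hout : ∀ N, IsMinimalSurfaceImage h N → N ⊆ closure (S.exterior : Set X) → N ⊆ range S.f)
    (hconn : IsConnected (S.exterior : Set X)) {U : Opens X} (B : MinimalBoundary h (U : Set X))
    (hUV : (U : Set X) = (S.exterior : Set X) \ trappedSet h (S.exterior : Set X))
    (hne : (U : Set X).Nonempty) :
    (U : Set X) = (S.exterior : Set X) ∧ range B.f = range S.f := by
  have hUV' : (U : Set X) ⊆ (S.exterior : Set X) := hUV ▸ sdiff_subset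
  -- `∂U ⊆ S`
  have hBS : range B.f ⊆ range S.f := by
    cases isEmpty_or_nonempty B.surf with
    | inl _ => simp [Set.range_eq_empty]
    | inr _ =>
      exact hout _ B.isMinimalSurfaceImage_range
        (B.range_subset_closure.trans (closure_mono hUV'))
  -- `V ∩ ∂U = ∅`, hence `V ⊆ U`
  have hfr : Disjoint (S.exterior : Set X) (frontier (U : Set X)) := by
    rw [B.frontier_eq]
    refine Set.disjoint_left.2 fun x hxV hxB ↦ ?_
    have hx : x ∈ range S.f ∩ (S.exterior : Set X) := ⟨hBS hxB, hxV⟩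
    rw [S.range_inter_exterior] at hx
    exact hx
  have hVU : (S.exterior : Set X) ⊆ (U : Set X) :=
    subset_of_isPreconnected_of_frontier_disjoint hconn.isPreconnected U.isOpen hUV' hne hfr
  have hUVeq : (U : Set X) = (S.exterior : Set X) := hUV'.antisymm hVU
  refine ⟨hUVeq, ?_⟩
  rw [← S.frontier_exterior, ← B.frontier_eq, hUVeq]

/-- Under the hypotheses of `OutermostMOTS.exterior_eq_of_outermost`, the trapped set of the
exterior does not meet it: `K(S.exterior) ∩ S.exterior = ∅` (the outermost horizon encloses the
whole trapped region of the end). Huisken–Ilmanen 2001, §4, Lemma 4.1 (i).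
[cite: HuiskenIlmanenIMCF2001, §4, Lemma 4.1 (i)] -/
theorem OutermostMOTS.trappedSet_inter_exterior_eq_empty
    {h : ContMDiffRiemannianMetric (𝓡 3) ∞ E3 (TangentSpace (𝓡 3) : X → Type _)}
    [(ofRiemannian h).HasLeviCivita] (S : OutermostMOTS (𝓡 3) h 0)
    (hout : ∀ N, IsMinimalSurfaceImage h N → N ⊆ closure (S.exterior : Set X) → N ⊆ range S.f)
    (hconn : IsConnected (S.exterior : Set X)) {U : Opens X} (B : MinimalBoundary h (U : Set X))
    (hUV : (U : Set X) = (S.exterior : Set X) \ trappedSet h (S.exterior : Set X))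
    (hne : (U : Set X).Nonempty) :
    trappedSet h (S.exterior : Set X) ∩ (S.exterior : Set X) = ∅ := by
  obtain ⟨hUVeq, -⟩ := S.exterior_eq_of_outermost hout hconn B hUV hne
  ext x
  simp only [mem_inter_iff, mem_empty_iff_false, iff_false, not_and]
  intro hxK hxV
  have hxU : x ∈ (U : Set X) := hUVeq ▸ hxV
  rw [hUV] at hxU
  exact hxU.2 hxK

/-! ### Reduction of the general-horizon Penrose inequality to the exterior-region form -/

/-- **gr.S09, general horizon: the reduction to Bray's Theorem 19, proved.** The named facts
`exteriorRegion_structure` (Huisken–Ilmanen 2001, Lemma 4.1 (i), `ExteriorRegion.lean`) and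
`Bray2001_penrose_inequality_exteriorRegion` (Bray 2001, Thm. 19, with Huisken–Ilmanen's
Lemma 4.1 (ii)) imply `riemannian_penrose_inequality_outermost`. Proof (reduction (b) of the module
docstring of `MassInequalities.lean`): let `V = S.exterior`, with minimal boundary `S`
(`OutermostMOTS.toMinimalBoundary`, using the smoothness of `S.ν`); Lemma 4.1 gives the exterior
component `U = V ∖ K(V)` of the end `e`, an exterior region (`IsExteriorRegion e U`) with compact
minimal boundary `B` and no compact minimal surface in `closure U` outside `∂U`
(`subset_frontier_of_isMinimalSurfaceImage`); by `OutermostMOTS.exterior_eq_of_outermost`,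
`U = V` and `∂U = S`; Thm. 19 for `U`, applied to the compact surface `S.surf` embedded into
`∂U` by `S.f`, is the claim (`S.surfaceArea = totalArea (S.f^* h)` by definition).
[cite: BrayRPI2001, Thm. 19 (p. 240)] [cite: HuiskenIlmanenIMCF2001, §4, Lemma 4.1] -/
theorem riemannian_penrose_inequality_outermost_of_exteriorRegion
    (h1 : exteriorRegion_structure) (h2 : Bray2001_penrose_inequality_exteriorRegion) :
    riemannian_penrose_inequality_outermost := by
  intro X _ _ _ _ _ _ D _ e S hν _hts hR hAF hRq hcomp hADM hout hext
  -- the exterior `V = S.exterior` with its minimal boundary `S`, and its exterior component `U`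
  obtain ⟨-, U, B, hUV, hUext, -⟩ := h1 X D e S.exterior (S.toMinimalBoundary hν)
    hcomp hext hAF.isMetricAsymptoticallyFlat
  -- `U = V` and `∂U = S`
  obtain ⟨-, hBS⟩ := S.exterior_eq_of_outermost hout hext.isConnected B hUV hUext.nonempty
  -- no other compact minimal surfaces in `closure U`
  have hiii : ∀ N, IsMinimalSurfaceImage D.h N → N ⊆ closure (U : Set X) → N ⊆ range B.f := by
    intro N hN hNU
    rw [← B.frontier_eq]
    exact subset_frontier_of_isMinimalSurfaceImage U.isOpen hUV hN hNU
  -- Thm. 19 for the exterior region `U`, applied to `S` embedded into `∂U`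
  exact h2 X D e U B hcomp hUext hAF.isMetricAsymptoticallyFlat hRq hADM (fun x _ ↦ hR x) hiii
    S.surf S.f S.hpb S.isSpacelikeImmersion S.isEmbedding hBS.ge

/-! ### The printed-outermost variant without Huisken–Ilmanen's Lemma 4.1 (i)

Under the hypotheses of `riemannian_penrose_inequality_outermost` the open set `V = S.exterior` is
*itself* an exterior region of the end `e` in the sense of the exterior-region facts: it is
connected and compact modulo the end (`IsExteriorRegion e S.exterior` is a hypothesis), its
topological boundary is the compact minimal surface `S` with smooth unit normal pointing into it
(`OutermostMOTS.toMinimalBoundary`, from the hypothesis that `S.ν` is smooth; its boundary map is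
`S.f` by `rfl`), and the outermost hypothesis in printed form (every image of a compact immersed
minimal surface contained in `closure S.exterior` lies in `range S.f`) is verbatim the hypothesis
"no other compact minimal surfaces (even immersed)" of `Bray2001_penrose_inequality_exteriorRegion`
for `U := S.exterior`. Hence Bray's Thm. 19 for exterior regions applies to `U := S.exterior` and
`Σ₀ := S` directly, and the passage through the exterior component `U = V ∖ K(V)` of Lemma 4.1 (i)
followed by `U = V` (`OutermostMOTS.exterior_eq_of_outermost`) in
`riemannian_penrose_inequality_outermost_of_exteriorRegion` is not needed. This is Bray's remark
preceding Thm. 19 (§13: *"none of the arguments in this paper have used anything about the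
original manifold inside the original horizon `Σ₀`"*) read in the open-set encoding — only
`S.exterior` and its boundary enter — and the sibling, for the inequality, of
`riemannian_penrose_rigidity_outermost_of_penrose_rigidity_exteriorRegion`
(`PenroseRigidityProofs.lean`). Consequently the trust base of
`riemannian_penrose_inequality_outermost` is `Bray2001_penrose_inequality_exteriorRegion` alone, and
its discharge `riemannian_penrose_inequality_outermost_holds` is the theorem below applied to the
discharge of that fact (Bray's Thm. 19 itself, not in the tree). -/

/-- **gr.S09, general horizon (printed-outermost variant): the reduction to Bray's Theorem 19
alone, proved.** The named fact `Bray2001_penrose_inequality_exteriorRegion` (Bray,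
J. Differential Geom. 59 (2001), Thm. 19 (p. 240), in the exterior-region encoding, with
Huisken–Ilmanen's Lemma 4.1 (ii)) implies `riemannian_penrose_inequality_outermost`, without
`exteriorRegion_structure` (compare `riemannian_penrose_inequality_outermost_of_exteriorRegion`):
the fact is applied to the exterior region `U := S.exterior` of `e` (`IsExteriorRegion`, a
hypothesis) with minimal boundary `S.toMinimalBoundary hν` — whose hypothesis "no other compact
immersed minimal surface in `closure U`" is the printed outermost hypothesis of the statement,
and nonnegative scalar curvature being asked on all of `X` — and to the compact surface `S.surf`
embedded into `∂U = range S.f` by `S.f` itself (`S.surfaceArea = totalArea (S.f^* h)` by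
definition), giving `√(|S|/16π) ≤ E = e.admEnergy D`. In particular the discharge of
`riemannian_penrose_inequality_outermost` needs `Bray2001_penrose_inequality_exteriorRegion` only.
[cite: BrayRPI2001, Thm. 19 (p. 240) and the remark preceding it (§13)]
[cite: HuiskenIlmanenIMCF2001, §4, Lemma 4.1 (ii)] -/
theorem riemannian_penrose_inequality_outermost_of_penrose_inequality_exteriorRegion
    (h2 : Bray2001_penrose_inequality_exteriorRegion) :
    riemannian_penrose_inequality_outermost := by
  intro X _ _ _ _ _ _ D _ e S hν _hts hR hAF hRq hcomp hADM hout hext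
  -- Thm. 19 for the exterior region `S.exterior` with minimal boundary `S`, applied to `S`
  -- embedded into its own image
  exact h2 X D e S.exterior (S.toMinimalBoundary hν) hcomp hext hAF.isMetricAsymptoticallyFlat hRq
    hADM (fun x _ ↦ hR x) hout S.surf S.f S.hpb S.isSpacelikeImmersion S.isEmbedding subset_rfl

end Reduction

end Literature.Geometry.Lorentzian

end
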